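import Summits.QuantumFields.YangMills.Theorems.BalabanUVNodesN12EtaSizeDefs
import Summits.QuantumFields.YangMills.Theorems.BalabanUVNodesN12NearFlatDelta2Letter

/-!
# BalabanUVNodes ∕ N12 — (J-b) module H7: THE (δ₂) LETTER IN PRINT's η-UNITS `qEta` (item (iii) of dag-n12-c g18's LANE WORD «LOCATED-RHO ⇒ exit (b)», EXISTENCE edition):
# `qEta (𝐁_k(Z)) k (DΨ(0)w − DΦ♭(0)w) ≤ C·‖↑U₀ − 1‖·p(w)`, ONE `C, ρ` per height — dag-n12-w4's sup-currency `exists_delta2_letter_Bj` re-read through the row-weight exchange `qEta v ≤ √(Σ_i levelWeight j_i)·‖v‖`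

Cell `pub-ymgap` (HUMAN RULINGS D-0062 ∕ D-0149), width seat `pub-ymgap-dag-n10-w1` g4.  `--kind proof --supports stmt-QuantumFields-27364 --as helper`; count-neutral; THEOREMS ONLY (0 `def`, 0 `sorry`).  CONSUMED BY
NAME, nothing modified: this lineage's Defs file `…N12EtaSizeDefs` (`levelWeight`, `qEta`, `qEta_sq`, `levelWeight_pos`; p627654) and dag-n12-w4 g3's `…N12NearFlatDelta2Letter.exists_delta2_letter_Bj` (p618836∕p620953:
the sup-currency (δ₂) from my module D).  The LANE WORD (INBOX 2026-08-28 l.35963, (iii)) asked for the (δ₂) letter in `q_η`-currency; LOCATED-RHO-2 (l.≈36157) sized its two editions: the ℓ²-GAIN edition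
(`‖defect(j,c)‖ ≤ C‖↑U₀−1‖·L^{j(1−d∕2)}·‖w|_{N(c)}‖_{ℓ²}`, composite `ρ·δ₂ = O(√k·C·δc)`) is analytic and OPEN; THIS FILE is the NO-GAIN edition the existence road of (χ)∕`hNFn_of_letters_eta_on` consumes today:
the sup letter times the total row weight `√(Σ_i levelWeight j_i)` (a per-instance number), i.e. `δ₂c_η := C·√(Σ_i levelWeight j_i)·‖↑U₀ − 1‖` folded into ONE per-height-and-instance constant.

CONTENTS (ns `Summit.QuantumFields.YangMills.BalabanUVNodes.N12NearFlatDelta2LetterEta`).  §1 `sum_levelWeight_nonneg`, ★ `qEta_le_sqrt_sum_mul_norm` (`qEta 𝔹 k v ≤ √(Σ_i levelWeight j_i)·‖v‖`).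
§2 ★★★ `exists_delta2_letter_Bj_qEta` — `∃ C ρ, 0 ≤ C ∧ 0 < ρ ∧` for every guarded `U₀` with `‖↑U₀ − 1‖ < ρ`, every datum `W` agreeing with `M˙U₀` on `𝐁_k(Z)`, every direction `w`:
`qEta (Bj M₁ Z k) k (DΨ(0)w − DΦ♭(0)w) ≤ C·‖↑U₀ − 1‖·p(w)` (`p` any seminorm dominating the bond-`ℓ²` operator norms, as in J-C's `hp`).

HONEST FRAMING.  Re-currencying by name; `C, ρ` are per-height∕instance EXISTENCE constants (module D's smoothness constants × the row-weight total) — NOT print's k-uniform (δ₂), and WITHOUT the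
ℓ²-locality gain that exit (b) ultimately needs (open); nothing of Bałaban's asserted; N12 ∕ N10 NOT discharged; K1⁹ NOT closed; count-neutral (typed 28∕28 · discharged 5∕27 unmoved); one finite 𝕋⁴ programme at
fixed ε — R4 closes the conditional finite-𝕋⁴ rung `BalabanLadder.UV` only; the YM mass gap (Clay) is NOT proved by any of this.
-/

noncomputable section
open scoped BigOperators Matrix.Norms.L2Operator
open Finset
namespace Summit.QuantumFields.YangMills.BalabanUVNodes.N12NearFlatDelta2LetterEta

open Literature.MathematicalPhysics.QuantumFieldTheory.Balaban1983to89
open T4Continuum (T4Family)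
open ExpMeanLog (deltaSU)
open BlockAveragingEMLLinearised (linAvg)
open T4AdjointCovarianceUnitary (lieSU)
open B15DeterminingSets
open B14.Eq213DetSet (Bj)
open Node00
open Summit.QuantumFields.YangMills.Theorems.BlockAvgCorrector (stokesConst)
open Summit.QuantumFields.YangMills.BalabanUVNodes.N12EtaSizeDefs (levelWeight qEta qEta_sq levelWeight_pos)
open Summit.QuantumFields.YangMills.BalabanUVNodes.N12NearFlatDelta2Letter (exists_delta2_letter_Bj)

/-! ## §1  The row-weight exchange: `qEta v ≤ √(Σ_i levelWeight j_i)·‖v‖` -/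

section Exchange

variable {P : Params} {N : ℕ}

/-- The total row weight is non-negative. [cite: Balaban1989LargeFieldII, (17)-(19) pp.360-361 (bookkeeping)] -/
theorem sum_levelWeight_nonneg (𝔹 : DetSet P) (k : ℕ) : 0 ≤ ∑ i : Fin (constrCard 𝔹 k), levelWeight P (((constrEnum 𝔹 k).symm i).1 : ℕ) :=
  Finset.sum_nonneg fun _ _ => (levelWeight_pos _).le

/-- ★ **`qEta v ≤ √(Σ_i levelWeight j_i)·‖v‖`** (each row's `𝔰𝔲(N)`-norm is at most the sup; the weights add up). [cite: Balaban1989LargeFieldII, (17)-(19) pp.360-361 (bookkeeping)] -/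
theorem qEta_le_sqrt_sum_mul_norm (𝔹 : DetSet P) (k : ℕ) (v : Fin (constrCard 𝔹 k) → lieSU (Fin N)) :
    qEta 𝔹 k v ≤ Real.sqrt (∑ i : Fin (constrCard 𝔹 k), levelWeight P (((constrEnum 𝔹 k).symm i).1 : ℕ)) * ‖v‖ := by
  have hW := sum_levelWeight_nonneg 𝔹 k
  have hsq : qEta 𝔹 k v ^ 2 ≤ (Real.sqrt (∑ i : Fin (constrCard 𝔹 k), levelWeight P (((constrEnum 𝔹 k).symm i).1 : ℕ)) * ‖v‖) ^ 2 := by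
    rw [qEta_sq, mul_pow, Real.sq_sqrt hW, Finset.sum_mul]
    refine Finset.sum_le_sum fun i _ => mul_le_mul_of_nonneg_left ?_ (levelWeight_pos _).le
    exact pow_le_pow_left₀ (norm_nonneg _) (norm_le_pi_norm v i) 2
  have h0 : 0 ≤ Real.sqrt (∑ i : Fin (constrCard 𝔹 k), levelWeight P (((constrEnum 𝔹 k).symm i).1 : ℕ)) * ‖v‖ := by positivity
  exact (pow_le_pow_iff_left₀ (N12EtaSizeDefs.qEta_nonneg 𝔹 k v) h0 two_ne_zero).1 hsq

end Exchange

/-! ## §2  The (δ₂) letter in `qEta`-units at `𝐁_k(Z)`, existence edition -/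

section Letter

variable {F : T4Family} {N : ℕ} [NeZero N] {K : ℕ}

/-- ★★★ **THE (δ₂) LETTER IN PRINT's η-UNITS, PER HEIGHT** (item (iii), no-gain edition): ONE `C ≥ 0`, `ρ > 0` such that for every guarded `U₀` (`Ū^i(U₀)` `t₀`-small below `k`, `stokesConst·t₀ < δ_N`) with
`‖↑U₀ − 1‖ < ρ`, every datum `W` agreeing with `M˙U₀` on `𝐁_k(Z)`, and every `w`:  `qEta (Bj M₁ Z k) k (DΨ(0)w − DΦ♭(0)w) ≤ C·‖↑U₀ − 1‖·p(w)`  (dag-n12-w4's sup-currency `exists_delta2_letter_Bj` ∘ §1; the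
constant absorbs `√(Σ_i levelWeight j_i)`). [cite: Balaban1989LargeFieldII, (1.12) p.359, (17)-(19) pp.360-361; Balaban1985Variational, (44)-(48) p.285, (82)-(83) p.290] -/
theorem exists_delta2_letter_Bj_qEta (k M₁ : ℕ) (Z : Set (Site (F.P K) 0))
    (Q : (i : ℕ) → (PBond (F.P K) 0 → Matrix (Fin N) (Fin N) ℂ) → PBond (F.P K) i → Matrix (Fin N) (Fin N) ℂ)
    (hQ0 : ∀ Y, Q 0 Y = Y) (hQs : ∀ (i : ℕ) (Y : PBond (F.P K) 0 → Matrix (Fin N) (Fin N) ℂ) (c : PBond (F.P K) (i + 1)), Q (i + 1) Y c = linAvg (Q i Y) c)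
    (p : Seminorm ℝ (PBond (F.P K) 0 → lieSU (Fin N)))
    (hp : ∀ Y : PBond (F.P K) 0 → lieSU (Fin N), ∑ b, ‖(Y b : Matrix (Fin N) (Fin N) ℂ)‖ ^ 2 ≤ p Y ^ 2) :
    ∃ C ρ : ℝ, 0 ≤ C ∧ 0 < ρ ∧ ∀ ⦃t₀ : ℝ⦄, 0 < t₀ → stokesConst (F.P K) * t₀ < deltaSU (Fin N) →
      ∀ (U₀ : GaugeField (F.P K) 0 (SU N)) (W : MSField (F.P K) (SU N)),
        (∀ i, i < k → PlaqSmall t₀ (Averaging.iter (avOfRecord F N K) i U₀)) → ‖coeField U₀ - 1‖ < ρ →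
        AgreeOn (Bj M₁ Z k) (avgFamily (avOfRecord F N K) U₀) W →
        ∀ w : PBond (F.P K) 0 → lieSU (Fin N),
          qEta (Bj M₁ Z k : DetSet (F.P K)) k
              (fderiv ℝ (msChart F N K k (Bj M₁ Z k) W U₀) 0 w
                - fderiv ℝ (msChart F N K k (Bj M₁ Z k) (avgFamily (avOfRecord F N K) (1 : GaugeField (F.P K) 0 (SU N))) (1 : GaugeField (F.P K) 0 (SU N))) 0 w)
            ≤ C * ‖coeField U₀ - 1‖ * p w := by
  obtain ⟨C, ρ, hC, hρ, h⟩ := exists_delta2_letter_Bj (F := F) (N := N) (K := K) k M₁ Z Q hQ0 hQs p hp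
  set Wt : ℝ := Real.sqrt (∑ i : Fin (constrCard (Bj M₁ Z k : DetSet (F.P K)) k), levelWeight (F.P K) (((constrEnum (Bj M₁ Z k : DetSet (F.P K)) k).symm i).1 : ℕ)) with hWt
  have hWt0 : 0 ≤ Wt := Real.sqrt_nonneg _
  refine ⟨Wt * C, ρ, mul_nonneg hWt0 hC, hρ, fun t₀ ht₀ hstδ U₀ W hsm hU₀ hU w => ?_⟩
  have h1 := h ht₀ hstδ U₀ W hsm hU₀ hU w
  have h2 := qEta_le_sqrt_sum_mul_norm (Bj M₁ Z k : DetSet (F.P K)) k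
    (fderiv ℝ (msChart F N K k (Bj M₁ Z k) W U₀) 0 w
      - fderiv ℝ (msChart F N K k (Bj M₁ Z k) (avgFamily (avOfRecord F N K) (1 : GaugeField (F.P K) 0 (SU N))) (1 : GaugeField (F.P K) 0 (SU N))) 0 w)
  calc _ ≤ Wt * ‖fderiv ℝ (msChart F N K k (Bj M₁ Z k) W U₀) 0 w
            - fderiv ℝ (msChart F N K k (Bj M₁ Z k) (avgFamily (avOfRecord F N K) (1 : GaugeField (F.P K) 0 (SU N))) (1 : GaugeField (F.P K) 0 (SU N))) 0 w‖ := h2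
    _ ≤ Wt * (C * ‖coeField U₀ - 1‖ * p w) := mul_le_mul_of_nonneg_left h1 hWt0
    _ = Wt * C * ‖coeField U₀ - 1‖ * p w := by ring

end Letter

end Summit.QuantumFields.YangMills.BalabanUVNodes.N12NearFlatDelta2LetterEta
end
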